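import Summits.ABC.ABC.Theses.RibetTakahashiSplit
import Literature.NumberTheory.DiophantineGeometry.ConductorRadicalProofs

/-!
# The θ-ladder of item `EigenformLowerBound` (stmt-ABC-1755), arithmetic side: per-factorisation
# valuation bounds on covering sets give the valuation product, and `θ = 0` gives r2

Route `RibetTakahashiSplit`, support item stmt-ABC-1755 (`EigenformLowerBound`, informal — no Lean
signature yet). Its text asserts: "EigenformLowerBound(θ) for the ≤ 3 factorisations covering all
multiplicative primes gives `T(E) ≤ C N^{3θ+ε}`; θ = 0 is exactly r2" (`ManyPrimeValuationProduct`,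
stmt-ABC-1561), where `T(E) = ∏_{p ∥ N} ord_p(Δ_min(E))`. On ONE Shimura curve `X_0^D(M)` the eigenform
bound with exponent `θ` yields, through the Ribet–Takahashi–Pasten identity (H. Pasten, *Shimura curves
and the abc conjecture*, J. Number Theory 254 (2024) = arXiv:1705.09251, Thm 6.1(b) and §16), the
PER-FACTORISATION bound `T_D(E) := ∏_{p ∈ D} ord_p(Δ_min) ≤ C_ε N^{θ+ε}` for the set `D` of primes
dividing the quaternion discriminant — an even set of `≥ 2` multiplicative primes whose complement among
the multiplicative primes has `≥ 2` elements (Pasten's hypotheses (b.1)/(b.2): the co-level `M = N/∏D`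
keeps two multiplicative primes). This file proves the purely arithmetic half of the item's sentence,
with every abbreviation of the crux line `jl-zero-cycle-height` written out (no definitions):

* `prod_factorization_le_mul_of_sdiff_subset` — `T_S ≤ T_A · T_B` for `A ⊆ S`, `S ∖ A ⊆ B ⊆`
  multiplicative primes (every factor is `≥ 1`: a prime of the conductor divides the minimal
  discriminant, `radical_conductorNorm_eq_holds`);
* `exists_three_coveringSets` — with `≥ 4` multiplicative primes there are three covering sets
  `D₁, D₂, D₃` with `T(E) ≤ T_{D₁} T_{D₂} T_{D₃}`;
* `valuationProduct_le_of_pairedBoundTheta` — **the ladder**: if `T_D ≤ C_ε N^{θ+ε}` for every covering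
  set of every curve semistable away from `2`, then `T(E) ≤ C'_ε N^{3θ+ε}` for every such curve with
  `≥ 4` multiplicative primes;
* `manyPrimeValuationProduct_of_pairedBound` — **θ = 0 gives r2** (`ManyPrimeValuationProduct`, by name);
* `pairedBound_of_manyPrime_of_fewPrime` — conversely r2 ∧ r4 (`FewPrimeValuationProduct`, needed only on
  the sliver "`2 ∥ N` and exactly three odd multiplicative primes") give the per-factorisation bound at
  `θ = 0` back, so at `θ = 0` the per-factorisation statement is sandwiched between r2 ∧ r4 and r2.

The analytic half (eigenform bound on `X_0^D(M)` ⟹ per-factorisation bound) needs the Shimura-curve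
vocabulary of the wanted definition `ShimuraCurveIntegralForms`; a typed candidate over the crux line's
posited interface, with that implication kernel-checked modulo the in-print package, is attached to the
item as evidence (`EigenformLowerBound.lean`).
-/

-- `Summit.ABC.ABC` is the mandated summit-side namespace (CONVENTIONS §2); the duplicate is deliberate.
set_option linter.dupNamespace false

namespace Summit.ABC.ABC.Theorems.EigenformLowerBound

open Finset
open Summit.ABC.ABC.Theses.RibetTakahashiSplit (ManyPrimeValuationProduct FewPrimeValuationProduct)
variable {W : WeierstrassCurve ℚ}

/-- Every factor `ord_p(Δ_min)` at a multiplicative prime `p` (`p ∣ N`, `p² ∤ N`) is `≥ 1`: a prime of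
the conductor divides the minimal discriminant (`radical_conductorNorm_eq_holds`). [folklore] -/
theorem one_le_factorization_of_mem_filter [W.IsElliptic] {p : ℕ}
    (hp : p ∈ (W.conductorNorm ℤ).primeFactors.filter (fun p => ¬ p ^ 2 ∣ W.conductorNorm ℤ)) :
    1 ≤ (W.minimalDiscriminantNorm ℤ).factorization p := by
  have hrad : UniqueFactorizationMonoid.radical (W.conductorNorm ℤ) =
      UniqueFactorizationMonoid.radical (W.minimalDiscriminantNorm ℤ) :=
    W.radical_conductorNorm_eq_holds
  have hpf : (W.conductorNorm ℤ).primeFactors = (W.minimalDiscriminantNorm ℤ).primeFactors := by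
    rw [← Nat.primeFactors_radical, hrad, Nat.primeFactors_radical]
  have hp1 : p ∈ (W.conductorNorm ℤ).primeFactors := (Finset.mem_filter.mp hp).1
  rw [hpf] at hp1
  obtain ⟨hpp, hpd, hne⟩ := Nat.mem_primeFactors.mp hp1
  exact hpp.factorization_pos_of_dvd hne hpd

/-- Splitting a valuation product: `T_S ≤ T_A · T_B` for `A ⊆ S` and `S ∖ A ⊆ B ⊆` multiplicative
primes (all factors over multiplicative primes are `≥ 1`). [folklore] -/
theorem prod_factorization_le_mul_of_sdiff_subset [W.IsElliptic] {S A B : Finset ℕ} (hA : A ⊆ S)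
    (hSB : S \ A ⊆ B)
    (hB : B ⊆ (W.conductorNorm ℤ).primeFactors.filter (fun p => ¬ p ^ 2 ∣ W.conductorNorm ℤ)) :
    ∏ p ∈ S, (W.minimalDiscriminantNorm ℤ).factorization p ≤
      (∏ p ∈ A, (W.minimalDiscriminantNorm ℤ).factorization p) *
        ∏ p ∈ B, (W.minimalDiscriminantNorm ℤ).factorization p := by
  classical
  rw [← Finset.prod_sdiff hA, mul_comm]
  refine Nat.mul_le_mul_left _ ?_
  exact Finset.prod_le_prod_of_subset_of_one_le' hSB
    (fun p hp _ => one_le_factorization_of_mem_filter (hB hp))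

/-- Monotonicity: `T_D ≤ T_S` for `D ⊆ S ⊆` multiplicative primes. [folklore] -/
theorem prod_factorization_mono [W.IsElliptic] {D S : Finset ℕ} (hDS : D ⊆ S)
    (hS : S ⊆ (W.conductorNorm ℤ).primeFactors.filter (fun p => ¬ p ^ 2 ∣ W.conductorNorm ℤ)) :
    ∏ p ∈ D, (W.minimalDiscriminantNorm ℤ).factorization p ≤
      ∏ p ∈ S, (W.minimalDiscriminantNorm ℤ).factorization p := by
  classical
  exact Finset.prod_le_prod_of_subset_of_one_le' hDS
    (fun p hp _ => one_le_factorization_of_mem_filter (hS hp))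

/-- **Three covering sets.** If `W` has `≥ 4` multiplicative primes `S`, there are three subsets
`D₁, D₂, D₃ ⊆ S`, each of even cardinality `≥ 2` with `#(S ∖ Dᵢ) ≥ 2`, such that
`T_S ≤ T_{D₁} T_{D₂} T_{D₃}` (`#S` even: `S ∖ {a,b}`, `{a,b}`, `{a,b}`; `#S` odd: `S ∖ {a,b,c}`,
`{a,b}`, `{a,c}`). [folklore] -/
theorem exists_three_coveringSets [W.IsElliptic]
    (h4 : 4 ≤ ((W.conductorNorm ℤ).primeFactors.filter (fun p => ¬ p ^ 2 ∣ W.conductorNorm ℤ)).card) :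
    ∃ D₁ D₂ D₃ : Finset ℕ,
      (∀ D ∈ [D₁, D₂, D₃],
        D ⊆ (W.conductorNorm ℤ).primeFactors.filter (fun p => ¬ p ^ 2 ∣ W.conductorNorm ℤ) ∧
        Even D.card ∧ 2 ≤ D.card ∧
        2 ≤ (((W.conductorNorm ℤ).primeFactors.filter (fun p => ¬ p ^ 2 ∣ W.conductorNorm ℤ)) \ D).card) ∧
      ∏ p ∈ (W.conductorNorm ℤ).primeFactors.filter (fun p => ¬ p ^ 2 ∣ W.conductorNorm ℤ),
          (W.minimalDiscriminantNorm ℤ).factorization p ≤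
        (∏ p ∈ D₁, (W.minimalDiscriminantNorm ℤ).factorization p) *
          (∏ p ∈ D₂, (W.minimalDiscriminantNorm ℤ).factorization p) *
          ∏ p ∈ D₃, (W.minimalDiscriminantNorm ℤ).factorization p := by
  classical
  set S := (W.conductorNorm ℤ).primeFactors.filter (fun p => ¬ p ^ 2 ∣ W.conductorNorm ℤ) with hS
  set v : ℕ → ℕ := fun p => (W.minimalDiscriminantNorm ℤ).factorization p with hv
  -- three distinct multiplicative primes
  obtain ⟨a, ha⟩ : S.Nonempty := Finset.card_pos.mp (by omega)
  obtain ⟨b, hb⟩ : (S.erase a).Nonempty :=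
    Finset.card_pos.mp (by rw [Finset.card_erase_of_mem ha]; omega)
  obtain ⟨c, hc⟩ : ((S.erase a).erase b).Nonempty :=
    Finset.card_pos.mp (by rw [Finset.card_erase_of_mem hb, Finset.card_erase_of_mem ha]; omega)
  have hba : b ≠ a := (Finset.mem_erase.mp hb).1
  have hbS : b ∈ S := (Finset.mem_erase.mp hb).2
  have hcb : c ≠ b := (Finset.mem_erase.mp hc).1
  have hc' : c ∈ S.erase a := (Finset.mem_erase.mp hc).2
  have hca : c ≠ a := (Finset.mem_erase.mp hc').1
  have hcS : c ∈ S := (Finset.mem_erase.mp hc').2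
  have hab : a ≠ b := hba.symm
  have hpab : ({a, b} : Finset ℕ) ⊆ S := by
    intro x hx; rcases Finset.mem_insert.mp hx with rfl | hx
    · exact ha
    · rwa [Finset.mem_singleton.mp hx]
  have hpac : ({a, c} : Finset ℕ) ⊆ S := by
    intro x hx; rcases Finset.mem_insert.mp hx with rfl | hx
    · exact ha
    · rwa [Finset.mem_singleton.mp hx]
  have hcab : ({a, b} : Finset ℕ).card = 2 := Finset.card_pair hab
  -- a pair of multiplicative primes is a covering set
  have covPair : ∀ {x y : ℕ}, x ≠ y → ({x, y} : Finset ℕ) ⊆ S →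
      ({x, y} : Finset ℕ) ⊆ S ∧ Even ({x, y} : Finset ℕ).card ∧ 2 ≤ ({x, y} : Finset ℕ).card ∧
        2 ≤ (S \ {x, y}).card := by
    intro x y hxy hsub
    refine ⟨hsub, ?_, ?_, ?_⟩
    · rw [Finset.card_pair hxy]; exact even_two
    · rw [Finset.card_pair hxy]
    · rw [Finset.card_sdiff_of_subset hsub, Finset.card_pair hxy]; omega
  have hD₂ := covPair hab hpab
  have hD₃ := covPair hca.symm hpac
  have h1ab : 1 ≤ ∏ p ∈ ({a, b} : Finset ℕ), v p :=
    Finset.one_le_prod' fun p hp => one_le_factorization_of_mem_filter (hpab hp)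
  rcases Nat.even_or_odd S.card with heven | hodd
  · -- even: D₁ = S ∖ {a,b}, D₂ = D₃ = {a,b}
    refine ⟨S \ {a, b}, {a, b}, {a, b}, ?_, ?_⟩
    · intro D hD
      simp only [List.mem_cons, List.not_mem_nil, or_false] at hD
      rcases hD with rfl | rfl | rfl
      · refine ⟨Finset.sdiff_subset, ?_, ?_, ?_⟩
        · rw [Finset.card_sdiff_of_subset hpab, hcab]
          exact (Nat.even_sub (by omega)).mpr (by simp [heven])
        · rw [Finset.card_sdiff_of_subset hpab, hcab]; omega
        · rw [Finset.sdiff_sdiff_eq_self hpab, hcab]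
      · exact hD₂
      · exact hD₂
    · have h1 : ∏ p ∈ S, v p ≤ (∏ p ∈ S \ {a, b}, v p) * ∏ p ∈ ({a, b} : Finset ℕ), v p :=
        prod_factorization_le_mul_of_sdiff_subset Finset.sdiff_subset
          (by rw [Finset.sdiff_sdiff_eq_self hpab]) hpab
      calc ∏ p ∈ S, v p ≤ (∏ p ∈ S \ {a, b}, v p) * ∏ p ∈ ({a, b} : Finset ℕ), v p := h1
        _ ≤ (∏ p ∈ S \ {a, b}, v p) * (∏ p ∈ ({a, b} : Finset ℕ), v p) *
              ∏ p ∈ ({a, b} : Finset ℕ), v p := Nat.le_mul_of_pos_right _ h1ab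
  · -- odd: D₁ = S ∖ {a,b,c}, D₂ = {a,b}, D₃ = {a,c}
    have hpabc : ({a, b, c} : Finset ℕ) ⊆ S := by
      intro x hx
      rcases Finset.mem_insert.mp hx with rfl | hx
      · exact ha
      rcases Finset.mem_insert.mp hx with rfl | hx
      · exact hbS
      · rwa [Finset.mem_singleton.mp hx]
    have hcabc : ({a, b, c} : Finset ℕ).card = 3 :=
      Finset.card_eq_three.mpr ⟨a, b, c, hab, hca.symm, hcb.symm, rfl⟩
    have h5 : 5 ≤ S.card := by
      rcases hodd with ⟨k, hk⟩; omega
    refine ⟨S \ {a, b, c}, {a, b}, {a, c}, ?_, ?_⟩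
    · intro D hD
      simp only [List.mem_cons, List.not_mem_nil, or_false] at hD
      rcases hD with rfl | rfl | rfl
      · refine ⟨Finset.sdiff_subset, ?_, ?_, ?_⟩
        · rw [Finset.card_sdiff_of_subset hpabc, hcabc]
          refine (Nat.even_sub (by omega)).mpr ⟨fun h => ?_, fun h => ?_⟩
          · exact absurd h (Nat.not_even_iff_odd.mpr hodd)
          · exact absurd h (by decide)
        · rw [Finset.card_sdiff_of_subset hpabc, hcabc]; omega
        · rw [Finset.sdiff_sdiff_eq_self hpabc, hcabc]; omega
      · exact hD₂
      · exact hD₃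
    · have h1 : ∏ p ∈ S, v p ≤ (∏ p ∈ S \ {a, b, c}, v p) * ∏ p ∈ ({a, b, c} : Finset ℕ), v p :=
        prod_factorization_le_mul_of_sdiff_subset Finset.sdiff_subset
          (by rw [Finset.sdiff_sdiff_eq_self hpabc]) hpabc
      have hsub2 : ({a, b} : Finset ℕ) ⊆ {a, b, c} := by
        intro x hx
        rcases Finset.mem_insert.mp hx with rfl | hx
        · exact Finset.mem_insert_self _ _
        · rw [Finset.mem_singleton.mp hx]
          exact Finset.mem_insert_of_mem (Finset.mem_insert_self _ _)
      have hrest : ({a, b, c} : Finset ℕ) \ {a, b} ⊆ {a, c} := by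
        intro x hx
        have hx1 := (Finset.mem_sdiff.mp hx).1
        have hx2 := (Finset.mem_sdiff.mp hx).2
        rcases Finset.mem_insert.mp hx1 with rfl | hx1
        · exact Finset.mem_insert_self _ _
        rcases Finset.mem_insert.mp hx1 with rfl | hx1
        · exact absurd (Finset.mem_insert_of_mem (Finset.mem_singleton_self _)) hx2
        · rw [Finset.mem_singleton.mp hx1]
          exact Finset.mem_insert_of_mem (Finset.mem_singleton_self _)
      have h2 : ∏ p ∈ ({a, b, c} : Finset ℕ), v p ≤
          (∏ p ∈ ({a, b} : Finset ℕ), v p) * ∏ p ∈ ({a, c} : Finset ℕ), v p :=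
        prod_factorization_le_mul_of_sdiff_subset hsub2 hrest hpac
      calc ∏ p ∈ S, v p ≤ (∏ p ∈ S \ {a, b, c}, v p) * ∏ p ∈ ({a, b, c} : Finset ℕ), v p := h1
        _ ≤ (∏ p ∈ S \ {a, b, c}, v p) *
              ((∏ p ∈ ({a, b} : Finset ℕ), v p) * ∏ p ∈ ({a, c} : Finset ℕ), v p) :=
            Nat.mul_le_mul_left _ h2
        _ = (∏ p ∈ S \ {a, b, c}, v p) * (∏ p ∈ ({a, b} : Finset ℕ), v p) *
              ∏ p ∈ ({a, c} : Finset ℕ), v p := by ring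

/-- **The θ-ladder** (item `EigenformLowerBound`, arithmetic half): if for every `ε > 0` there is `C`
with `T_D(E) ≤ C N^{θ+ε}` for every elliptic `W/ℚ` semistable away from `2` and every covering set `D`
(an even set of `≥ 2` multiplicative primes whose complement among the multiplicative primes has `≥ 2`
elements), then for every `ε > 0` there is `C'` with `T(E) = ∏_{p ∥ N} ord_p(Δ_min) ≤ C' N^{3θ+ε}` for
every such `W` with `≥ 4` multiplicative primes (three covering sets, `T ≤ T_{D₁}T_{D₂}T_{D₃}`; the paired
bound at `ε/3`, `C' = (max C 1)³`). -/
theorem valuationProduct_le_of_pairedBoundTheta (θ : ℝ)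
    (hP : ∀ ε : ℝ, 0 < ε → ∃ C : ℝ, ∀ (W : WeierstrassCurve ℚ) [W.IsElliptic],
      (∀ p : ℕ, p.Prime → p ≠ 2 → ¬ p ^ 2 ∣ W.conductorNorm ℤ) → ∀ D : Finset ℕ,
        D ⊆ (W.conductorNorm ℤ).primeFactors.filter (fun p => ¬ p ^ 2 ∣ W.conductorNorm ℤ) →
        Even D.card → 2 ≤ D.card →
        2 ≤ (((W.conductorNorm ℤ).primeFactors.filter (fun p => ¬ p ^ 2 ∣ W.conductorNorm ℤ)) \ D).card →
        ((∏ p ∈ D, (W.minimalDiscriminantNorm ℤ).factorization p : ℕ) : ℝ) ≤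
          C * (W.conductorNorm ℤ : ℝ) ^ (θ + ε)) :
    ∀ ε : ℝ, 0 < ε → ∃ C : ℝ, ∀ (W : WeierstrassCurve ℚ) [W.IsElliptic],
      (∀ p : ℕ, p.Prime → p ≠ 2 → ¬ p ^ 2 ∣ W.conductorNorm ℤ) →
      4 ≤ ((W.conductorNorm ℤ).primeFactors.filter (fun p => ¬ p ^ 2 ∣ W.conductorNorm ℤ)).card →
      ((∏ p ∈ (W.conductorNorm ℤ).primeFactors with ¬ p ^ 2 ∣ W.conductorNorm ℤ,
          (W.minimalDiscriminantNorm ℤ).factorization p : ℕ) : ℝ) ≤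
        C * (W.conductorNorm ℤ : ℝ) ^ (3 * θ + ε) := by
  intro ε hε
  obtain ⟨C, hC⟩ := hP (ε / 3) (by positivity)
  refine ⟨(max C 1) ^ 3, fun W _ hss h4 => ?_⟩
  obtain ⟨D₁, D₂, D₃, hcov, hprod⟩ := exists_three_coveringSets (W := W) h4
  have hN0' : 0 < W.conductorNorm ℤ := W.conductorNorm_pos_holds
  set N : ℝ := (W.conductorNorm ℤ : ℝ) with hNdef
  have hN0 : 0 < N := by rw [hNdef]; exact_mod_cast hN0'
  have hb : ∀ D ∈ [D₁, D₂, D₃],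
      ((∏ p ∈ D, (W.minimalDiscriminantNorm ℤ).factorization p : ℕ) : ℝ) ≤
        max C 1 * N ^ (θ + ε / 3) := by
    intro D hD
    obtain ⟨hsub, heven, h2, h2'⟩ := hcov D hD
    exact (hC W hss D hsub heven h2 h2').trans
      (mul_le_mul_of_nonneg_right (le_max_left _ _) (Real.rpow_nonneg hN0.le _))
  have hpow : (N ^ (θ + ε / 3)) ^ (3 : ℕ) = N ^ (3 * θ + ε) := by
    rw [← Real.rpow_natCast, ← Real.rpow_mul hN0.le]; ring_nf
  calc ((∏ p ∈ (W.conductorNorm ℤ).primeFactors with ¬ p ^ 2 ∣ W.conductorNorm ℤ,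
          (W.minimalDiscriminantNorm ℤ).factorization p : ℕ) : ℝ)
        ≤ ((∏ p ∈ D₁, (W.minimalDiscriminantNorm ℤ).factorization p : ℕ) : ℝ) *
          ((∏ p ∈ D₂, (W.minimalDiscriminantNorm ℤ).factorization p : ℕ) : ℝ) *
          ((∏ p ∈ D₃, (W.minimalDiscriminantNorm ℤ).factorization p : ℕ) : ℝ) := by
        exact_mod_cast hprod
    _ ≤ (max C 1 * N ^ (θ + ε / 3)) * (max C 1 * N ^ (θ + ε / 3)) * (max C 1 * N ^ (θ + ε / 3)) := by
        gcongr
        · exact hb D₁ (by simp)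
        · exact hb D₂ (by simp)
        · exact hb D₃ (by simp)
    _ = (max C 1) ^ 3 * (N ^ (θ + ε / 3)) ^ (3 : ℕ) := by ring
    _ = (max C 1) ^ 3 * N ^ (3 * θ + ε) := by rw [hpow]

/-- **θ = 0 gives r2.** If `T_D(E) ≤ C_ε N^ε` for every covering set `D` of every elliptic `W/ℚ`
semistable away from `2`, then `ManyPrimeValuationProduct` holds (curves with `≥ 4` ODD multiplicative
primes have `≥ 4` multiplicative primes). -/
theorem manyPrimeValuationProduct_of_pairedBound
    (hP : ∀ ε : ℝ, 0 < ε → ∃ C : ℝ, ∀ (W : WeierstrassCurve ℚ) [W.IsElliptic],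
      (∀ p : ℕ, p.Prime → p ≠ 2 → ¬ p ^ 2 ∣ W.conductorNorm ℤ) → ∀ D : Finset ℕ,
        D ⊆ (W.conductorNorm ℤ).primeFactors.filter (fun p => ¬ p ^ 2 ∣ W.conductorNorm ℤ) →
        Even D.card → 2 ≤ D.card →
        2 ≤ (((W.conductorNorm ℤ).primeFactors.filter (fun p => ¬ p ^ 2 ∣ W.conductorNorm ℤ)) \ D).card →
        ((∏ p ∈ D, (W.minimalDiscriminantNorm ℤ).factorization p : ℕ) : ℝ) ≤
          C * (W.conductorNorm ℤ : ℝ) ^ ε) :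
    ManyPrimeValuationProduct := by
  have hP0 := valuationProduct_le_of_pairedBoundTheta 0 (by simpa only [zero_add] using hP)
  intro ε hε
  obtain ⟨C, hC⟩ := hP0 ε hε
  refine ⟨C, fun W _ hss h4 => ?_⟩
  have hS4 : 4 ≤ ((W.conductorNorm ℤ).primeFactors.filter
      (fun p => ¬ p ^ 2 ∣ W.conductorNorm ℤ)).card := by
    refine le_trans h4 (Finset.card_le_card fun p hp => ?_)
    simp only [Finset.mem_filter] at hp ⊢
    exact ⟨hp.1, hp.2.2⟩
  simpa only [mul_zero, zero_add] using hC W hss hS4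

/-- **Conversely, r2 ∧ r4 give the per-factorisation bound at θ = 0**: `T_D ≤ T(E)` (all factors
`≥ 1`), and `T(E) ≤ C N^ε` by r2 when `W` has `≥ 4` odd multiplicative primes, by r4
(`FewPrimeValuationProduct`) otherwise — a covering set forces `≥ 4` multiplicative primes, one of
which may be `2`. So at `θ = 0` the per-factorisation statement lies between r2 ∧ r4 and r2. [folklore] -/
theorem pairedBound_of_manyPrime_of_fewPrime (h2 : ManyPrimeValuationProduct)
    (h4 : FewPrimeValuationProduct) :
    ∀ ε : ℝ, 0 < ε → ∃ C : ℝ, ∀ (W : WeierstrassCurve ℚ) [W.IsElliptic],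
      (∀ p : ℕ, p.Prime → p ≠ 2 → ¬ p ^ 2 ∣ W.conductorNorm ℤ) → ∀ D : Finset ℕ,
        D ⊆ (W.conductorNorm ℤ).primeFactors.filter (fun p => ¬ p ^ 2 ∣ W.conductorNorm ℤ) →
        Even D.card → 2 ≤ D.card →
        2 ≤ (((W.conductorNorm ℤ).primeFactors.filter (fun p => ¬ p ^ 2 ∣ W.conductorNorm ℤ)) \ D).card →
        ((∏ p ∈ D, (W.minimalDiscriminantNorm ℤ).factorization p : ℕ) : ℝ) ≤
          C * (W.conductorNorm ℤ : ℝ) ^ ε := by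
  intro ε hε
  obtain ⟨C₂, hC₂⟩ := h2 ε hε
  obtain ⟨C₄, hC₄⟩ := h4 ε hε
  refine ⟨max C₂ C₄, fun W _ hss D hsub _ _ _ => ?_⟩
  have hN0' : 0 < W.conductorNorm ℤ := W.conductorNorm_pos_holds
  have hNε : 0 ≤ (W.conductorNorm ℤ : ℝ) ^ ε := Real.rpow_nonneg (by exact_mod_cast hN0'.le) _
  have hTD : ((∏ p ∈ D, (W.minimalDiscriminantNorm ℤ).factorization p : ℕ) : ℝ) ≤
      ((∏ p ∈ (W.conductorNorm ℤ).primeFactors with ¬ p ^ 2 ∣ W.conductorNorm ℤ,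
          (W.minimalDiscriminantNorm ℤ).factorization p : ℕ) : ℝ) := by
    exact_mod_cast prod_factorization_mono hsub subset_rfl
  rcases le_or_gt 4 (((W.conductorNorm ℤ).primeFactors.filter
      (fun p => p ≠ 2 ∧ ¬ p ^ 2 ∣ W.conductorNorm ℤ)).card) with hge | hlt
  · exact hTD.trans ((hC₂ W hss hge).trans (mul_le_mul_of_nonneg_right (le_max_left _ _) hNε))
  · exact hTD.trans ((hC₄ W hss (by omega)).trans (mul_le_mul_of_nonneg_right (le_max_right _ _) hNε))

end Summit.ABC.ABC.Theorems.EigenformLowerBound
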